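import Mathlib
import HarnessLib
import Literature.Probability.Percolation.ContinuityCriterion

/-!
# `stub_chiFiniteOfRadiusMoment` of line `registered` (crux `TruncatedSusceptibilityFiniteOfTheta`,
# stmt-CriticalPhenomena-0852): volume from radius

Registered stub `stub_chiFiniteOfRadiusMoment` of the lead's skeleton
`Cruxes/TruncatedSusceptibilityFiniteOfTheta/Lines/birth.lean`, stated over tree declarations only.

Statement: for bond percolation on `ℤ³` at ANY density `p`, a finite second shell moment of the
finite-cluster radius gives a finite truncated susceptibility,
`Σ_n (n+1)² · P_p(0 ↔ ∂B(n), |C(0)| < ∞) < ∞ ⟹ χᶠ(p) = Σ_x P_p(0 ↔ x, |C(0)| < ∞) < ∞`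
(Grimmett 1999, (8.49)–(8.51): the deterministic/counting passage "volume from radius").

Proof. (i) FIRST EXIT: for `x ∉ B(m)` and `ω ⊆ E(ℤ³)` (hence `P_p`-a.s.,
`DCT16.real_mono_of_forall_subset_edgeSet`), an open path `0 → x` leaves `B(m)` through its inner vertex
boundary (`exists_innerBoundary_reachable_of_walk`), so
`{0 ↔ x, |C| < ∞} ⊆ {0 ↔ ∂B(m) in B(m), |C| < ∞}` and `τᶠ_p(0,x) ≤ P_p(0 ↔ ∂B(m), |C| < ∞)`
(the proof of `tau_le_real_siteToBoundary` with the extra conjunct `|C(0)| < ∞` carried along).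
(ii) SHELL COUNT: `#(B(K+1) \ B(K)) = (2K+3)³ − (2K+1)³ = 24K² + 48K + 26 ≤ 26 (K+1)²` (`card_box`).
(iii) SUMMATION (`summable_of_sum_le`, nonnegative terms): every finite `s ⊆ ℤ³` lies in some `B(K)`, and
by induction on `K` (peeling the shells `B(K+1) \ B(K)`),
`Σ_{x ∈ B(K)} τᶠ(x) ≤ 1 + 26 Σ_{m < K} (m+1)² P_p(0 ↔ ∂B(m), |C| < ∞) ≤ 1 + 26 Σ_m (m+1)² P_p(…)`.
-/

noncomputable section

namespace Summit.CriticalPhenomena.PercolationContinuityZ3.Theorems.TruncatedSusceptibilityFiniteOfTheta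

open MeasureTheory Literature.Probability.Percolation Literature.Probability.LatticeModels

namespace StubChiFiniteOfRadiusMoment

/-- **First exit with a finite cluster**: for `x ∉ B(m)`,
`P_p(0 ↔ x, |C(0)| < ∞) ≤ P_p(0 ↔ ∂B(m) in B(m), |C(0)| < ∞)` (valid for `ω ⊆ E(ℤ³)`, hence a.s.). -/
theorem real_openConn_diff_le (p : unitInterval) {m : ℕ} {x : Site 3} (hx : x ∉ box 3 m) :
    (bondPercolation (zdGraph 3) p).real (openConn 0 x \ percolatesAt 0) ≤
      (bondPercolation (zdGraph 3) p).real (siteToBoundary 3 m \ percolatesAt 0) := by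
  classical
  refine DCT16.real_mono_of_forall_subset_edgeSet (zdGraph 3) p fun ω hω h => ?_
  refine ⟨?_, h.2⟩
  have hle : openGraph ω ≤ zdGraph 3 := fun a b hab => by
    rw [openGraph_adj] at hab
    exact (SimpleGraph.mem_edgeSet _).1 (hω hab.1)
  have h' : (openGraph ω).Reachable 0 x := h.1
  obtain ⟨w⟩ := h'
  have h0 : (0 : Site 3) ∈ box 3 m := by simp [mem_box]
  obtain ⟨b, hb, hu, hb', hreach⟩ := exists_innerBoundary_reachable_of_walk hle (box 3 m) w h0 hx
  exact ⟨b, hb, hu, hb', hreach⟩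

/-- **Shell count**: `#(B(K+1) \ B(K)) = (2K+3)³ − (2K+1)³ = 24K² + 48K + 26 ≤ 26 (K+1)²`. -/
theorem card_shell_le (K : ℕ) : (box 3 (K + 1) \ box 3 K).card ≤ 26 * (K + 1) ^ 2 := by
  have hsub : box 3 K ⊆ box 3 (K + 1) := box_mono 3 (Nat.le_add_right K 1)
  have h := Finset.card_sdiff_add_card_eq_card hsub
  rw [card_box, card_box] at h
  ring_nf at h ⊢
  omega

/-- Every finite set of sites lies in some box `B(L)`. -/
theorem exists_subset_box (s : Finset (Site 3)) : ∃ L : ℕ, s ⊆ box 3 L := by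
  refine ⟨s.sup fun x => Finset.univ.sup fun i => (x i).natAbs, fun x hx => ?_⟩
  rw [mem_box]
  intro i
  have h1 : (x i).natAbs ≤ Finset.univ.sup (fun i => (x i).natAbs) :=
    Finset.le_sup (f := fun i => (x i).natAbs) (Finset.mem_univ i)
  have h2 : (Finset.univ.sup fun i => (x i).natAbs) ≤ s.sup fun x => Finset.univ.sup fun i => (x i).natAbs :=
    Finset.le_sup (f := fun x => Finset.univ.sup fun i => (x i).natAbs) hx
  omega

/-- **Peeling the shells**: if `f ≤ 1` and `f x ≤ g m` whenever `x ∉ B(m)` (`g ≥ 0`), then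
`Σ_{x ∈ B(K)} f x ≤ 1 + 26 Σ_{m < K} (m+1)² g m`. -/
theorem sum_box_le {f : Site 3 → ℝ} {g : ℕ → ℝ} (hf1 : ∀ x, f x ≤ 1) (hg : ∀ m, 0 ≤ g m)
    (hfg : ∀ m x, x ∉ box 3 m → f x ≤ g m) (K : ℕ) :
    ∑ x ∈ box 3 K, f x ≤ 1 + 26 * ∑ m ∈ Finset.range K, ((m : ℝ) + 1) ^ 2 * g m := by
  induction K with
  | zero =>
    have h : ∑ x ∈ box 3 0, f x ≤ 1 := by
      calc ∑ x ∈ box 3 0, f x ≤ ∑ _x ∈ box 3 0, (1 : ℝ) := Finset.sum_le_sum fun x _ => hf1 x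
        _ = 1 := by rw [Finset.sum_const, card_box]; norm_num
    simpa using h
  | succ K ih =>
    have hsub : box 3 K ⊆ box 3 (K + 1) := box_mono 3 (Nat.le_add_right K 1)
    rw [← Finset.sum_sdiff hsub, Finset.sum_range_succ]
    have hshell : ∑ x ∈ box 3 (K + 1) \ box 3 K, f x ≤ 26 * (((K : ℝ) + 1) ^ 2 * g K) := by
      calc ∑ x ∈ box 3 (K + 1) \ box 3 K, f x ≤ ∑ _x ∈ box 3 (K + 1) \ box 3 K, g K :=
            Finset.sum_le_sum fun x hx => hfg K x (Finset.mem_sdiff.1 hx).2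
        _ = ((box 3 (K + 1) \ box 3 K).card : ℝ) * g K := by rw [Finset.sum_const, nsmul_eq_mul]
        _ ≤ (26 * ((K : ℝ) + 1) ^ 2) * g K := by
            refine mul_le_mul_of_nonneg_right ?_ (hg K)
            exact_mod_cast card_shell_le K
        _ = 26 * (((K : ℝ) + 1) ^ 2 * g K) := by ring
    linarith [ih, hshell]

/-- **Summation over shells**: if `0 ≤ f ≤ 1`, `0 ≤ g`, `f x ≤ g m` whenever `x ∉ B(m)`, and
`Σ_n (n+1)² g n < ∞`, then `f` is summable over `ℤ³` (all finite partial sums are bounded by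
`1 + 26 Σ_n (n+1)² g n`). -/
theorem summable_of_shell_bound {f : Site 3 → ℝ} {g : ℕ → ℝ} (hf0 : ∀ x, 0 ≤ f x)
    (hf1 : ∀ x, f x ≤ 1) (hg : ∀ m, 0 ≤ g m) (hfg : ∀ m x, x ∉ box 3 m → f x ≤ g m)
    (hs : Summable fun n : ℕ => ((n : ℝ) + 1) ^ 2 * g n) : Summable f := by
  refine summable_of_sum_le (c := 1 + 26 * ∑' n : ℕ, ((n : ℝ) + 1) ^ 2 * g n) (fun x => hf0 x)
    fun s => ?_
  obtain ⟨K, hK⟩ := exists_subset_box s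
  calc ∑ x ∈ s, f x ≤ ∑ x ∈ box 3 K, f x :=
        Finset.sum_le_sum_of_subset_of_nonneg hK fun x _ _ => hf0 x
    _ ≤ 1 + 26 * ∑ m ∈ Finset.range K, ((m : ℝ) + 1) ^ 2 * g m := sum_box_le hf1 hg hfg K
    _ ≤ 1 + 26 * ∑' n : ℕ, ((n : ℝ) + 1) ^ 2 * g n := by
        gcongr
        exact hs.sum_le_tsum _ fun n _ => mul_nonneg (by positivity) (hg n)

end StubChiFiniteOfRadiusMoment

/-- **STUB 3 `chiFiniteOfRadiusMoment`** (volume from radius): at every `p`,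
`Σ_n (n+1)² P_p(0 ↔ ∂B(n), |C| < ∞) < ∞ ⇒ Σ_x P_p(0 ↔ x, |C| < ∞) < ∞`. First exit (a.s., `ω ⊆ E(ℤ³)`):
for `x ∉ B(m)`, `{0 ↔ x, |C| < ∞} ⊆ {0 ↔ ∂B(m), |C| < ∞}`; shell count `#(B(K+1) \ B(K)) ≤ 26 (K+1)²`;
bounded partial sums of a nonnegative family (`summable_of_sum_le`). (Grimmett 1999, (8.49)–(8.51).) -/
theorem stub_chiFiniteOfRadiusMoment :
    ∀ p : unitInterval,
      (Summable fun n : ℕ => ((n : ℝ) + 1) ^ 2 * (bondPercolation (zdGraph 3) p).real (siteToBoundary 3 n \ percolatesAt 0)) →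
        Summable fun x : Site 3 => (bondPercolation (zdGraph 3) p).real (openConn 0 x \ percolatesAt 0) := by
  intro p hs
  exact StubChiFiniteOfRadiusMoment.summable_of_shell_bound
    (g := fun n => (bondPercolation (zdGraph 3) p).real (siteToBoundary 3 n \ percolatesAt 0))
    (fun _ => measureReal_nonneg) (fun _ => measureReal_le_one) (fun _ => measureReal_nonneg)
    (fun _ _ hx => StubChiFiniteOfRadiusMoment.real_openConn_diff_le p hx) hs

end Summit.CriticalPhenomena.PercolationContinuityZ3.Theorems.TruncatedSusceptibilityFiniteOfTheta

end
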